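import Summits.Ventures.CertifiedManyBodySolver.Cruxes.ThermalStiffnessCeilingU8b10_le_1o8.Disproof
import Summits.Ventures.CertifiedManyBodySolver.Observables.StiffnessThermalKineticHook
import Summits.HubbardSuperconductivity.HubbardLadder.Bounds.ThermalStiffnessCeilingCurrentMoments
import HarnessLib

/-!
# BN-decomp-2 — the KUBO SOCKET of K1: `K1 ⇐ limsup_L (DIA_L − PARA_L) ≤ 1/8`, and the three-number split
# `K1 ⇐ (∀ᶠ L, DIA_L ≤ κ⁺) ∧ (∀ᶠ L, π⁻ ≤ PARA_L) ∧ (κ⁺ − π⁻ ≤ 1/8)`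

Cell `pub/hubbard-floor` (D-0160), seat `hubbard-floor-idea-decomp` (lens «decomp»: «a proved split of K1
`ThermalStiffnessCeilingU8b10_le_1o8` whose pieces the FQ3 host could feed»), cycle 7 BY-PRODUCT. Bookkeeping on
tree API only; sorry-free target.

WHAT THIS IS NOT. Not a proof of K1 (it stays OPEN); no number of record lives here (the one decimal below is an
INSTRUMENT figure of hubbard-floor-eng-3's FQ3 κ column, kit j313970 / j316286, quoted BY VALUE as a hypothesis, never
as a theorem); not a `T_c`; superconductivity in the Hubbard model is NOT proved by anything in this file or this cell.

THE OBJECT. For the canonical `(N_L, S^z = 0)` sector `p` of `hubbardTorusTT' L 1 t′ U` at inverse temperature `β`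
(the binder of `thermalFluxLogZ L t′ U (1 − n) β θ`, verbatim), put
* `DIA_L := Re⟨K_p⟩_{β,p} / (2L²)` (`K = kinOpTT' L t′`; per site `⟨−k_x⟩/2 = κ/4` in the cell's words),
* `PARA_L := (β/2)·Re (J_p ; J_p)_Duh / L²` (`J = curOpTT' L t′`, `( ; )_Duh = Matrix.duhamel β H_p`), `PARA_L ≥ 0`,
* `KUBO_L := DIA_L − PARA_L` (the finite-volume Kubo / Scalapino–White–Zhang curvature stiffness of the sector).
The tree ALREADY proves the finite-`L` ceiling (pub-hubbard, `ThermalStiffnessCeilingCurrentMoments.lean`):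
`thermalStiffnessTT'_le_kin_sub_duhamel` — flux premise `β ρ_s θ² ≤ log Z_p(0) − log Z_p(θ)` on `|θ| ≤ θ₀` at a side
`L ≥ 3` ⇒ `ρ_s ≤ KUBO_L` (exact second-order endgame, no Taylor remainder: g4/g5's «lower cubic twin» is not needed).
What the tree did NOT have (checked: `Observables/StiffnessThermal{Kinetic,TorusLimit,SectorGibbsBridge,OddMoment,TrialGenerator}Hook`)
is the packaging of the EXACT Duhamel term into the sequence leaf `ObsThermalStiffnessSeqCeilingAtBeta`; the existing hooks
either drop `PARA` (ROUTE T-A, kinetic) or replace it by a static lower bound (odd moments; trial generators). Here: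

* §1 `stiffness_le_kubo` — finite `L ≥ 3`, general anchor, in the leaf's own binder.
* §2 `leafAtBeta_of_kubo_frequently_add` ⊇ `…_eventually_add` ⊇ `…_eventually` — the PARENT hook: `∀ ε > 0, ∀ᶠ L, KUBO_L ≤ c + ε`
  (i.e. `limsup_L KUBO_L ≤ c`) ⇒ `ObsThermalStiffnessSeqCeilingAtBeta t′ U n β c`; `leafAtBeta_of_dia_eventually_add` recovers
  ROUTE T-A (`PARA ≥ 0`), so every existing thermal hook factors through this one.
* §3 `leafAtBeta_of_dia_para_split` — THE SPLIT: `limsup DIA ≤ κ⁺`, `liminf PARA ≥ π⁻`, `κ⁺ − π⁻ ≤ c` ⇒ leaf `c`.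
* §4 K1 / K2 rows: `k1_of_kubo_eventually_add`, `k1_of_dia_para_split`, `k2leaf_of_dia_para_split` (every `U` of K2's box),
  and BY VALUE `k1_of_para_floor_at_instrument_dia`: with the β-blind instrument corner `κ⁺ = 0.4081043` (eng-3 FQ3 column,
  S0/S1/S2 at β·t = 10; NOT of record) K1 follows from `liminf_L PARA_L ≥ 0.2831043` — the PARA floor must capture ≥ 69.4 % of
  that DIA; against the float truth `DIA ≈ 0.2638` (eng-5 j299776, NOT certified) it is `≥ 0.1388` (52.6 %). The FQ3 capture
  of record with the [H,J] block is 0 % (kit j313972). So the split LOWERS NO BAR; it states the bar once, in K1's normalisation,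
  with both pieces typed, and it is the socket any future certified PARA floor (Krylov / generator / Duhamel block) plugs into.

References: ScalapinoWhiteZhang1993 §II (D_s = ⟨−k_x⟩ − Λ_xx); ParamekantiTrivediRanderia1998 eq. (3), §IV; HazraVermaRanderia2019
eqs. (2)–(4); DLS1978 Thm. 3.1 (Duhamel ≥ 0).
-/

noncomputable section

namespace Summit.Ventures.CertifiedManyBodySolver.Cruxes.ThermalStiffnessCeilingU8b10_le_1o8.KuboSocket

open Real Filter Topology Matrix
open Literature.MathematicalPhysics.QuantumLattice
open Summit.Ventures.CertifiedManyBodySolver.Observables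
open Summit.Ventures.CertifiedManyBodySolver.Theses

/-! ## §0 The three per-site numbers of the canonical sector -/

/-- The canonical-sector predicate at filling `n` and side `L` — literally the binder of `thermalFluxLogZ L t′ U (1 − n) β θ`. -/
abbrev sectorAt (n : ℝ) (L : ℕ) : Finset (Orb (FermionTorus 2 L)) → Prop := fun s =>
  s.card = 2 * ⌊(1 - (1 - n)) * (L : ℝ) ^ 2 / 2⌋₊ ∧
    2 * (s.filter fun i => (ofLex i).2 = 0).card = 2 * ⌊(1 - (1 - n)) * (L : ℝ) ^ 2 / 2⌋₊

/-- `DIA_L = Re⟨K_p⟩_{β,p}/(2L²)` — the diamagnetic (f-sum) term per site (`= κ/4` in the cell's words). [cite: ParamekantiTrivediRanderia1998, eq. (3)] -/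
def dia (tp U n β : ℝ) (L : ℕ) [NeZero L] : ℝ :=
  (gibbsState β ((hubbardTorusTT' L 1 tp U).toBlock (sectorAt n L) (sectorAt n L))
      ((kinOpTT' L tp).toBlock (sectorAt n L) (sectorAt n L))).re / (2 * (L : ℝ) ^ 2)

/-- `PARA_L = (β/2)·Re (J_p ; J_p)_Duh / L²` — the paramagnetic (current–current Duhamel) term per site. [cite: ScalapinoWhiteZhang1993, §II] -/
def para (tp U n β : ℝ) (L : ℕ) [NeZero L] : ℝ :=
  β / 2 * (duhamel β ((hubbardTorusTT' L 1 tp U).toBlock (sectorAt n L) (sectorAt n L))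
      ((Summit.HubbardSuperconductivity.HubbardLadder.Bounds.curOpTT' L tp).toBlock (sectorAt n L) (sectorAt n L))
      ((Summit.HubbardSuperconductivity.HubbardLadder.Bounds.curOpTT' L tp).toBlock (sectorAt n L) (sectorAt n L))).re /
    (L : ℝ) ^ 2

/-- `KUBO_L = DIA_L − PARA_L` — the finite-volume Kubo (curvature) stiffness of the sector, per site. [cite: ScalapinoWhiteZhang1993, §II] -/
def kubo (tp U n β : ℝ) (L : ℕ) [NeZero L] : ℝ := dia tp U n β L - para tp U n β L

/-- `PARA_L ≥ 0` for `β ≥ 0` (Duhamel self-correlation of a Hermitian block). [cite: DLS1978, Thm. 3.1] -/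
theorem para_nonneg {tp U n β : ℝ} (hβ : 0 ≤ β) (L : ℕ) [NeZero L] : 0 ≤ para tp U n β L := by
  have hH : ((hubbardTorusTT' L 1 tp U).toBlock (sectorAt n L) (sectorAt n L)).IsHermitian :=
    (hubbardTorusTT'_isHermitian L 1 tp U).submatrix _
  have hJ : ((Summit.HubbardSuperconductivity.HubbardLadder.Bounds.curOpTT' L tp).toBlock
      (sectorAt n L) (sectorAt n L)).IsHermitian :=
    (Summit.HubbardSuperconductivity.HubbardLadder.Bounds.isHermitian_curOpTT' (L := L) tp).submatrix _
  have h := hH.re_duhamel_self_nonneg hJ β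
  unfold para
  positivity

/-- `KUBO_L ≤ DIA_L`. -/
theorem kubo_le_dia {tp U n β : ℝ} (hβ : 0 ≤ β) (L : ℕ) [NeZero L] : kubo tp U n β L ≤ dia tp U n β L := by
  have := para_nonneg (tp := tp) (U := U) (n := n) hβ L
  unfold kubo; linarith

/-! ## §1 Finite volume: the flux premise at one side `L ≥ 3` forces `ρ_s ≤ KUBO_L` -/

/-- **Finite-`L` Kubo ceiling in the leaf's binder** (`L ≥ 3`, any anchor, `β > 0`, `θ₀ > 0`): if
`β ρ_s θ² ≤ thermalFluxLogZ(0) − thermalFluxLogZ(θ)` for `|θ| ≤ θ₀`, then `ρ_s ≤ DIA_L − PARA_L`.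
(The tree's `thermalStiffnessTT'_le_kin_sub_duhamel`, divided by `L²`.) [cite: ScalapinoWhiteZhang1993, §II] -/
theorem stiffness_le_kubo {tp U n β ρs θ₀ : ℝ} (hβ : 0 < β) (hθ₀ : 0 < θ₀) {L : ℕ} [NeZero L] (hL : 3 ≤ L)
    (hst : ∀ θ : ℝ, |θ| ≤ θ₀ →
      β * ρs * θ ^ 2 ≤ thermalFluxLogZ L tp U (1 - n) β 0 - thermalFluxLogZ L tp U (1 - n) β θ) :
    ρs ≤ kubo tp U n β L := by
  have hL0 : (0 : ℝ) < (L : ℝ) := by exact_mod_cast (show 0 < L by omega)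
  have hL2 : (0 : ℝ) < (L : ℝ) ^ 2 := by positivity
  obtain ⟨h1, -⟩ :=
    Summit.HubbardSuperconductivity.HubbardLadder.Bounds.thermalStiffnessTT'_le_kin_sub_duhamel hL tp U hβ hθ₀
      (sectorAt n L) (by
        intro θ hθ
        have h := hst θ hθ
        simpa only [thermalFluxLogZ] using h)
  have key : ρs ≤
      ((gibbsState β ((hubbardTorusTT' L 1 tp U).toBlock (sectorAt n L) (sectorAt n L))
            ((kinOpTT' L tp).toBlock (sectorAt n L) (sectorAt n L))).re / 2 -
          β / 2 * (duhamel β ((hubbardTorusTT' L 1 tp U).toBlock (sectorAt n L) (sectorAt n L))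
            ((Summit.HubbardSuperconductivity.HubbardLadder.Bounds.curOpTT' L tp).toBlock (sectorAt n L) (sectorAt n L))
            ((Summit.HubbardSuperconductivity.HubbardLadder.Bounds.curOpTT' L tp).toBlock (sectorAt n L) (sectorAt n L))).re) /
        (L : ℝ) ^ 2 := by
    rw [le_div_iff₀ hL2]
    exact h1
  have e : kubo tp U n β L =
      ((gibbsState β ((hubbardTorusTT' L 1 tp U).toBlock (sectorAt n L) (sectorAt n L))
            ((kinOpTT' L tp).toBlock (sectorAt n L) (sectorAt n L))).re / 2 -
          β / 2 * (duhamel β ((hubbardTorusTT' L 1 tp U).toBlock (sectorAt n L) (sectorAt n L))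
            ((Summit.HubbardSuperconductivity.HubbardLadder.Bounds.curOpTT' L tp).toBlock (sectorAt n L) (sectorAt n L))
            ((Summit.HubbardSuperconductivity.HubbardLadder.Bounds.curOpTT' L tp).toBlock (sectorAt n L) (sectorAt n L))).re) /
        (L : ℝ) ^ 2 := by
    unfold kubo dia para
    field_simp
  rw [e]
  exact key

/-! ## §2 The parent hook: `limsup_L KUBO_L ≤ c` ⇒ the single-temperature leaf with constant `c` -/

/-- **Kubo ceiling up to `ε`, frequently along every divergent sequence of sides ⇒ the leaf** (weakest form). Given the
leaf's flux premise along `L_j → ∞` and `ε > 0`, ONE index with `L_j ≥ 3` and `KUBO_{L_j} ≤ c + ε` gives `ρ_s ≤ c + ε`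
(§1); let `ε → 0`. [cite: ScalapinoWhiteZhang1993, §II] [cite: ParamekantiTrivediRanderia1998, §IV] -/
theorem leafAtBeta_of_kubo_frequently_add {tp U n β : ℝ} (hβ : 0 < β) {c : ℚ}
    (hk : ∀ Ls : ℕ → ℕ, Tendsto Ls atTop atTop → ∀ ε : ℝ, 0 < ε →
      ∃ᶠ j : ℕ in atTop, ∀ [NeZero (Ls j)], kubo tp U n β (Ls j) ≤ ((c : ℚ) : ℝ) + ε) :
    ObsThermalStiffnessSeqCeilingAtBeta tp U n β c := by
  intro ρs θ₀ _hρs hθ₀ Ls hLs hst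
  refine le_of_forall_pos_le_add fun ε hε => ?_
  obtain ⟨j, hjk, hj3⟩ := ((hk Ls hLs ε hε).and_eventually (hLs.eventually_ge_atTop 3)).exists
  haveI : NeZero (Ls j) := ⟨by omega⟩
  have hkj : kubo tp U n β (Ls j) ≤ ((c : ℚ) : ℝ) + ε := hjk
  exact (stiffness_le_kubo hβ hθ₀ hj3 (fun θ hθ => hst j θ hθ)).trans hkj

/-- **The `limsup` form**: `∀ ε > 0, ∀ᶠ L, KUBO_L ≤ c + ε` ⇒ the leaf with constant `c`. [cite: ScalapinoWhiteZhang1993, §II] -/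
theorem leafAtBeta_of_kubo_eventually_add {tp U n β : ℝ} (hβ : 0 < β) {c : ℚ}
    (hk : ∀ ε : ℝ, 0 < ε → ∀ᶠ L : ℕ in atTop, ∀ [NeZero L], kubo tp U n β L ≤ ((c : ℚ) : ℝ) + ε) :
    ObsThermalStiffnessSeqCeilingAtBeta tp U n β c :=
  leafAtBeta_of_kubo_frequently_add hβ fun _Ls hLs ε hε => (hLs.eventually (hk ε hε)).frequently

/-- **The plain eventual form**: `∀ᶠ L, KUBO_L ≤ c` ⇒ the leaf with constant `c`. [cite: ScalapinoWhiteZhang1993, §II] -/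
theorem leafAtBeta_of_kubo_eventually {tp U n β : ℝ} (hβ : 0 < β) {c : ℚ}
    (hk : ∀ᶠ L : ℕ in atTop, ∀ [NeZero L], kubo tp U n β L ≤ ((c : ℚ) : ℝ)) :
    ObsThermalStiffnessSeqCeilingAtBeta tp U n β c :=
  leafAtBeta_of_kubo_eventually_add hβ fun ε hε => by
    filter_upwards [hk] with L hL
    intro hL0
    exact (@hL hL0).trans (le_add_of_nonneg_right hε.le)

/-- **Consistency: the DIA-only (ROUTE T-A, f-sum) hook factors through the Kubo socket** (`PARA ≥ 0`).
[cite: ParamekantiTrivediRanderia1998, eq. (3)] -/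
theorem leafAtBeta_of_dia_eventually_add {tp U n β : ℝ} (hβ : 0 < β) {c : ℚ}
    (hd : ∀ ε : ℝ, 0 < ε → ∀ᶠ L : ℕ in atTop, ∀ [NeZero L], dia tp U n β L ≤ ((c : ℚ) : ℝ) + ε) :
    ObsThermalStiffnessSeqCeilingAtBeta tp U n β c :=
  leafAtBeta_of_kubo_eventually_add hβ fun ε hε => by
    filter_upwards [hd ε hε] with L hL
    intro hL0
    exact (kubo_le_dia hβ.le L).trans (@hL hL0)

/-! ## §3 THE SPLIT: a DIA ceiling, a PARA floor, and one rational inequality -/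

/-- **Three-number split of the leaf** (any anchor, `β > 0`): `limsup_L DIA_L ≤ κ⁺` (as `∀ ε, ∀ᶠ L, DIA_L ≤ κ⁺ + ε`),
`liminf_L PARA_L ≥ π⁻` (as `∀ ε, ∀ᶠ L, π⁻ − ε ≤ PARA_L`) and `κ⁺ − π⁻ ≤ c` ⇒ `ObsThermalStiffnessSeqCeilingAtBeta t′ U n β c`.
DIA is what a thermal host's kinetic column certifies; PARA is what a current–current / [H,J]-block capture certifies.
[cite: ScalapinoWhiteZhang1993, §II] -/
theorem leafAtBeta_of_dia_para_split {tp U n β : ℝ} (hβ : 0 < β) {c : ℚ} {dmax pmin : ℝ}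
    (hd : ∀ ε : ℝ, 0 < ε → ∀ᶠ L : ℕ in atTop, ∀ [NeZero L], dia tp U n β L ≤ dmax + ε)
    (hp : ∀ ε : ℝ, 0 < ε → ∀ᶠ L : ℕ in atTop, ∀ [NeZero L], pmin - ε ≤ para tp U n β L)
    (hgap : dmax - pmin ≤ ((c : ℚ) : ℝ)) :
    ObsThermalStiffnessSeqCeilingAtBeta tp U n β c :=
  leafAtBeta_of_kubo_eventually_add hβ fun ε hε => by
    filter_upwards [hd (ε / 2) (by positivity), hp (ε / 2) (by positivity)] with L hL1 hL2
    intro hL0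
    have h1 := @hL1 hL0
    have h2 := @hL2 hL0
    unfold kubo
    linarith

/-- **Plain eventual split**: `∀ᶠ L, DIA_L ≤ κ⁺`, `∀ᶠ L, π⁻ ≤ PARA_L`, `κ⁺ − π⁻ ≤ c` ⇒ the leaf `c`. [cite: ScalapinoWhiteZhang1993, §II] -/
theorem leafAtBeta_of_dia_para_split_eventually {tp U n β : ℝ} (hβ : 0 < β) {c : ℚ} {dmax pmin : ℝ}
    (hd : ∀ᶠ L : ℕ in atTop, ∀ [NeZero L], dia tp U n β L ≤ dmax)
    (hp : ∀ᶠ L : ℕ in atTop, ∀ [NeZero L], pmin ≤ para tp U n β L)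
    (hgap : dmax - pmin ≤ ((c : ℚ) : ℝ)) :
    ObsThermalStiffnessSeqCeilingAtBeta tp U n β c :=
  leafAtBeta_of_dia_para_split hβ
    (fun ε hε => by
      filter_upwards [hd] with L hL
      intro hL0
      exact (@hL hL0).trans (le_add_of_nonneg_right hε.le))
    (fun ε hε => by
      filter_upwards [hp] with L hL
      intro hL0
      exact (sub_le_self pmin hε.le).trans (@hL hL0))
    hgap

/-! ## §4 The K1 / K2 rows -/

/-- **K1 through the Kubo socket**: `∀ ε > 0, ∀ᶠ L, KUBO_L(0, 8, ⅞, 10) ≤ 1/8 + ε` ⇒ K1. STRICTLY stronger than K1 (K1 only needs,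
for each `θ₀`, an eventual dip of the flux cost below `10·θ²/8` somewhere on `|θ| ≤ θ₀` — `FloorSetNormalForm.k1_iff_eventually_dip`),
and no producer exists today. [cite: ScalapinoWhiteZhang1993, §II] -/
theorem k1_of_kubo_eventually_add
    (hk : ∀ ε : ℝ, 0 < ε → ∀ᶠ L : ℕ in atTop, ∀ [NeZero L], kubo 0 8 (7 / 8) 10 L ≤ 1 / 8 + ε) :
    TcThermcert1.ThermalStiffnessCeilingU8b10_le_1o8 := by
  have e : (((1 / 8 : ℚ)) : ℝ) = 1 / 8 := by norm_num
  refine leafAtBeta_of_kubo_eventually_add (c := 1 / 8) (by norm_num) fun ε hε => ?_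
  rw [e]
  exact hk ε hε

/-- **K1 as a three-number split** (DIA ceiling `κ⁺`, PARA floor `π⁻`, `κ⁺ − π⁻ ≤ 1/8`). [cite: ScalapinoWhiteZhang1993, §II] -/
theorem k1_of_dia_para_split {dmax pmin : ℝ}
    (hd : ∀ ε : ℝ, 0 < ε → ∀ᶠ L : ℕ in atTop, ∀ [NeZero L], dia 0 8 (7 / 8) 10 L ≤ dmax + ε)
    (hp : ∀ ε : ℝ, 0 < ε → ∀ᶠ L : ℕ in atTop, ∀ [NeZero L], pmin - ε ≤ para 0 8 (7 / 8) 10 L)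
    (hgap : dmax - pmin ≤ 1 / 8) :
    TcThermcert1.ThermalStiffnessCeilingU8b10_le_1o8 := by
  have e : (((1 / 8 : ℚ)) : ℝ) = 1 / 8 := by norm_num
  exact leafAtBeta_of_dia_para_split (c := 1 / 8) (by norm_num) hd hp (by rw [e]; exact hgap)

/-- **K2's inner leaf at every `U` of the box through the same split** (`c = 9/71`; K2 = K1 → this for `U ∈ [7.9, 14.7]`).
[cite: ScalapinoWhiteZhang1993, §II] -/
theorem k2leaf_of_dia_para_split (U : ℝ) {dmax pmin : ℝ}
    (hd : ∀ ε : ℝ, 0 < ε → ∀ᶠ L : ℕ in atTop, ∀ [NeZero L], dia 0 U (7 / 8) 10 L ≤ dmax + ε)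
    (hp : ∀ ε : ℝ, 0 < ε → ∀ᶠ L : ℕ in atTop, ∀ [NeZero L], pmin - ε ≤ para 0 U (7 / 8) 10 L)
    (hgap : dmax - pmin ≤ 9 / 71) :
    ObsThermalStiffnessSeqCeilingAtBeta 0 U (7 / 8) 10 (9 / 71) := by
  have e : (((9 / 71 : ℚ)) : ℝ) = 9 / 71 := by norm_num
  exact leafAtBeta_of_dia_para_split (c := 9 / 71) (by norm_num) hd hp (by rw [e]; exact hgap)

/-- **BY VALUE (hypotheses, not theorems).** With the β-blind INSTRUMENT corner of the FQ3 κ column as the DIA ceiling,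
`κ⁺ = 0.4081043` (`= κ_cert/4`, eng-3 S0/S1 at `β·t = 10`, kit j313970 / j316286 — NOT a number of record), K1 follows from a
PARA floor `liminf_L PARA_L ≥ 0.2831043`, i.e. a certified current–current Duhamel term capturing ≥ 69.4 % of that DIA.
(Against the float truth `DIA ≈ 0.2638`, eng-5 j299776, the needed floor would be `0.1388`.) Today's certified capture with the
[H,J] block is 0 % (kit j313972): this row is a SOCKET, not a claim. [cite: ScalapinoWhiteZhang1993, §II] -/
theorem k1_of_para_floor_at_instrument_dia
    (hd : ∀ ε : ℝ, 0 < ε → ∀ᶠ L : ℕ in atTop, ∀ [NeZero L], dia 0 8 (7 / 8) 10 L ≤ 0.4081043 + ε)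
    (hp : ∀ ε : ℝ, 0 < ε → ∀ᶠ L : ℕ in atTop, ∀ [NeZero L], 0.2831043 - ε ≤ para 0 8 (7 / 8) 10 L) :
    TcThermcert1.ThermalStiffnessCeilingU8b10_le_1o8 :=
  k1_of_dia_para_split hd hp (by norm_num)

/-- Arithmetic of the by-value row: the needed PARA floor is `κ⁺ − 1/8` and its share of `κ⁺` is `> 69.3 %`
(`< 69.4 %`); against the float `0.2638` the share is `> 52.6 %`. Pure `norm_num`. -/
theorem byValue_shares :
    (0.4081043 : ℝ) - 1 / 8 = 0.2831043 ∧ (0.693 : ℝ) < 0.2831043 / 0.4081043 ∧ (0.2831043 : ℝ) / 0.4081043 < 0.694 ∧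
      (0.2638 : ℝ) - 1 / 8 = 0.1388 ∧ (0.526 : ℝ) < 0.1388 / 0.2638 := by
  refine ⟨by norm_num, ?_, ?_, by norm_num, ?_⟩
  · rw [lt_div_iff₀ (by norm_num)]; norm_num
  · rw [div_lt_iff₀ (by norm_num)]; norm_num
  · rw [lt_div_iff₀ (by norm_num)]; norm_num


end Summit.Ventures.CertifiedManyBodySolver.Cruxes.ThermalStiffnessCeilingU8b10_le_1o8.KuboSocket

end
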